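import Summits.QuantumFields.BalabanUV.Beta.FP.CompositeAveragingTablesInf
import Summits.QuantumFields.BalabanUV.Beta.FP.PerfectBiStencilFixedPoint
import Summits.QuantumFields.BalabanUV.Beta.DshAn1

/-!
# `BalabanUV.Beta.FP.PerfectSecondOrderTablesInf` — road «FP» for binder row D1, row **N1-J∞-W PART 3(b)** (owner d1-p3 g13, RULING R-FP-44 (B), journal
# l.32086), FILE D2 of the part: THE (0.4) LITERAL's COMPOSITE AVERAGING TABLES AT THE LIMIT `MCompInf`∕`M2CompInf`, THE m-FOLD SECOND-ORDER TABLE OF RECORD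
# `WtInf m := W2SymOfK (G m) (Lc^m) S∞ (MCompInf m) S₂∞ (M2CompInf m)`, AND THE PIN `WtPin` OF THE END's FREE FAMILY `Wt · m` (m ≥ 2) — R-FP-41′ AT THE LIMIT ONLY

HONEST DEPENDENCY (page 1, mandatory): continuum YM on T⁴ ⇐ BetaPertH ∧ nine spine estimates (0/9 proved); BetaPertH ⇐ (D1) ∧ (D4) ∧ CAP+tail;
G-an2-4 gates asym, D1 and NE2/3/4.  HONEST FRAMING (cell contract, verbatim): «discharging `BetaPertH` makes Bałaban's UV stability UNCONDITIONAL —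
a real constructive-QFT result; it is NOT the continuum limit and NOT the Clay problem.»  ABSOLUTE RULE (cell charter, verbatim): «No internally-minted
statement may enter as a cited fact. Every hypothesis is either kernel-proved in this package or a verbatim quotation of a PUBLISHED theorem with page
reference. The manuscript(s) under audit are NOT citable for their own disputed steps — they are the thing under adjudication; programme-internal
(2001/route/tribunal) claims are never citable.»  THIS MODULE DEFINES OUR OBJECTS (candidates asserting nothing; «not in print») and proves definitional
unfoldings, the `m = 1` pins against parts 1–2 of the row, and the behaviour of the pin under `WPerfOf`.  0 `def … : Prop`, nothing cited, 0 sorry; 0 estimates; 0∕4 row-D1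
binders; NOT X1m, NOT (STEP), NOT D1, NOT BetaPertH, NOT continuum, NOT Clay.  DEFINITION lane (reviewed).

WHY.  The terminal END (`RoadLeftLiteralWardTables.d1Drift_JsB12Sym_of_sliceLedger_straight_wardTables_tableParity`) takes `Wt : ℕ → ℕ → tables` with ONLY
`hWt1 : Wt j 1 = (JsB12Sym …).W`; its (hSDF)∕(hsplit) speak about `WPerfOf (sfStep Lc) (smStep 3 Lc) Wt m` for EVERY `m ≥ 1`, the members `m ≥ 2` being FREE.  RULING R-FP-44
(B): Q1 «the constant-in-units PIN is the intended reading of R-FP-41′ at the limit only» (`Wt j m := counitW_j (WtInf m)`, `m ≥ 2`, so that `WPerfOf … Wt m = WtInf m`); Q2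
«the GENUINE COMPOSITE `aComp qSym m`, BOTTOM recursion» (FILE D1 `CompositeAveragingTablesInf`); Q3 «`cT` is NOT a free letter — FIX it as the inter-level ratio of the `unitM`
scalings read off an4's `colM_unitK`»: PINNED here as **`lamPerfect := 1`** (D1's displayed inter-level conversion `λ`; the perfect-unit exponent count in D1's docstring gives `1`;
ARBITER = the m = 2 value check of [AN3-G59-MCOMP] (R-c) against an3 gen-35's exact composite tables, calc lane — if it rules otherwise the pin is ONE token).

CONTENT (generic `d`; `tabs : SymTables d Lc`, free `cΛ` — THE SAME scalar the END's consumer feeds through an4's `SecondOrderUnits.colM_unitK`∕`vertexOfM_unit` as the multiplier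
table's constant ((M-H): `unitM_j (tabs.M j) = cΛ • tabs.H`; R-FP-44 (B) «`cT` from `colM_unitK`»; OWNER GO l.32522 NIT), so the (SDF) consumer matches the letters BY NAME).
* §1 `qSym Lc ρ w κ u := ((d+1)!)⁻¹ · symLinAvgAt ρ_c (δ_{(κ,u)}) Lc ρ w` — THE ONE-STEP LINEARISED (0.4) AVERAGING WEIGHT of record, and `qSym_eq_border` : it IS the
  multiplier–field entry `(bhK Lc + Dsh Lc) (Lc•w) u (inr ρ) (inl κ)` of the level-0 symmetrised bordered Hessian of record (an1∕an2 `DshAn1.bhK_add_Dsh_inr_inl`; an3-g59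
  [AN3-G59-MCOMP] Q1 YES: ONE global `((d+1)!)⁻¹`, UNNORMALISED rooted counts, no `Lc^{−(d+1)}`; level-free in perfect units).
* §2 **`lamPerfect := 1`** (the pin), **`MCompInf tabs cΛ m := fun ρ w => cΛ • HComp Lc (qSym Lc) lamPerfect tabs.H m ρ w`**, **`M2CompInf tabs cΛ m := M2Comp Lc (qSym Lc) lamPerfect tabs.H tabs.mixFF cΛ m`**; `MCompInf_one` (`= fun ρ w =>
  cΛ • tabs.H ρ w` = the (M) limit `M∞` of g12 `PerfectTableFixedPoint.wPerfOf_JsB12Sym_eq_dress_of_ff` ∕ leaf-06 `…Sym`, by (M-H)(ShH)), `M2CompInf_one` (`= tabs.mixFF` = `M₂∞`,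
  (Shmix)); block shapes `MCompInf_inr`, `M2CompInf_inr` under (ShH)(Shmix)-type entry letters.
* §3 **`WtInf G tabs cΛ Sinf S₂inf m := W2SymOfK (G m) (Lc^m) Sinf (MCompInf tabs cΛ m) S₂inf (M2CompInf tabs cΛ m)`** with the K-SLOT FAMILY `G : ℕ → MKer` a PARAMETER —
  PLACEMENT CAVEAT OF R-FP-44 (B) Q2, DISPLAYED NOT RESOLVED: the owner's formula reads `G m := KPerf Lc (sfStep Lc) (smStep d Lc) m` (the STRAIGHT-contour composite
  resolvent, `PerfectColumnSemigroup`), while the literal's own `m = 1` carrier (parts 1–2: g12 `limTabOf_unitW_JsB12Sym0_eq`, leaf-06 `…_of_rows`) reads the K-slot at the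
  CO-DRESSED symmetrised resolvent `G∞ = coDressKSymAt ρ_c Lc (KPerf … 1)`; the tables `MCompInf`∕`M2CompInf` are the (0.4)-symmetrised composite; which placement the END's
  (SDF) consumes is governed by the dictionary rows #15–#22 (R-FP-40∕42, `LegShiftDictionary*`).  `WtInf_one` : at `m = 1`, `WtInf G … 1 = W2SymOfK (G 1) Lc Sinf (cΛ•H) S₂inf mixFF`
  — with `G 1 := G∞` and `(Sinf, S₂inf) := (S♭∞, S₂∞)` LITERALLY the right-hand side of leaf-06's `limTabOf_unitW_JsB12Sym0_eq_of_rows` (consistency with parts 1–2).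
* §4 **`WtPin Lc W₁ Winf j m := if m = 1 then W₁ j else unitW (sfStep Lc j)⁻¹ (smStep d Lc j)⁻¹ (Winf m)`** — the END's family with `m = 1` the literal's tables and `m ≥ 2`
  CONSTANT IN UNITS; `WtPin_one` (the END's `hWt1` shape), `unitW_WtPin_of_ne_one`, **`wPerfOf_WtPin_of_ne_one : m ≠ 1 → WPerfOf (sfStep Lc) (smStep d Lc) (WtPin Lc W₁ Winf) m = Winf m`**
  (`limTabOf` of a constant family), `wPerfOf_WtPin_one` (`m = 1`: the END's object `WPerfOf … (fun j _ => W₁ j) 1` unchanged).  With `Winf := WtInf G tabs cΛ S♭∞ S₂∞` the END's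
  (hSDF)∕(hsplit) for `m ≥ 2` become statements about ONE explicit carrier per `m` — the input N2a asks for.
NOT HERE: the letters of the composite tables (`VertexFamily (MCompInf m) (Lc^m)`, `LocStencilFM (Lc^m) (M2CompInf m)`; FILE D3) and any claim that (SDF) holds for `WtInf`.
Provenance: D1 formalisation swarm LEAF PROVER 02, unit b2b-balaban-beta-d1-formalise-leaf-02 gen 13, 2026-08-21 (R-FP-44 (B)).  No existing file touched.
-/

noncomputable section

namespace Summit.QuantumFields.BalabanUV.Beta.FP.PerfectSecondOrderTablesInf

open Filter Topology
open scoped Nat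
open Literature.Probability.LatticeModels (Torus.proj)
open Literature.MathematicalPhysics.QuantumFieldTheory
open Literature.MathematicalPhysics.QuantumFieldTheory.Balaban1983to89
open Literature.MathematicalPhysics.QuantumFieldTheory.Balaban1983to89.Beta
open ExpKernelCalculus (MKer)
open AffineAveraging (Site)
open AveragingContoursRooted (ctr)
open KKTFluctuationKernel (delta1)
open LatticeForm (quo)
open OneStepResolventKernel (Fib quo_zsmul proj_zsmul)
open SecondOrderResponse (W2SymOfK)
open HessKerDressedLimit (limTabOf limTabOf_apply limMKerOf_eq_of_tendsto)
open Summit.QuantumFields.BalabanUV.Beta.SymmetrisedAxialPotential (symLinAvgAt)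
open Summit.QuantumFields.BalabanUV.Beta.BorderedHessian (bhK)
open Summit.QuantumFields.BalabanUV.Beta.DshAn1 (Dsh bhK_add_Dsh_inr_inl)
open Summit.QuantumFields.BalabanUV.Beta.SymmetrisedStepJets (SymTables)
open Summit.QuantumFields.BalabanUV.Beta.HessKerDressedUnits (unitW)
open Summit.QuantumFields.BalabanUV.Beta.D1BFx.UnitsOnlyK (unitW_unitW_inv)
open Summit.QuantumFields.BalabanUV.Beta.GAN24.CombesThomas (sfStep smStep sfStep_ne_zero smStep_ne_zero)
open Summit.QuantumFields.BalabanUV.Beta.FP.PerfectObjectsT (WPerfOf)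
open Summit.QuantumFields.BalabanUV.Beta.FP.CompositeAveragingTablesInf (HComp M2Comp HComp_one M2Comp_one HComp_inr M2Comp_inr)

variable {d : ℕ}

/-! ## §1 The one-step linearised (0.4) averaging weight of record -/

/-- [our object — a CANDIDATE asserting nothing] **THE ONE-STEP LINEARISED (0.4) AVERAGING WEIGHT** at blocking `L` with the centred root: the weight of the fine bond
`(κ, u)` in the linear average prescribed at the coarse bond `(ρ, w)`, `((d+1)!)⁻¹ · symLinAvgAt ρ_c (δ_{(κ,u)}) L ρ w` (the S_{d+1}-mean of the rooted comb averagings of the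
unit form; g11's parked v0, un-parked by R-FP-44 (B)). -/
def qSym (L : ℕ) (ρ : Fin (d + 1)) (w : Site (d + 1)) (κ : Fin (d + 1)) (u : Site (d + 1)) : ℝ :=
  ((d + 1) ! : ℝ)⁻¹ * symLinAvgAt (ctr (d + 1) L) (delta1 κ u) L ρ w

/-- [folklore] **`qSym` IS THE MULTIPLIER–FIELD ENTRY OF THE SYMMETRISED BORDERED HESSIAN OF RECORD** (`bhK L + Dsh L`, an1∕an2 `DshAn1.bhK_add_Dsh_inr_inl`) read at the
coarse point `L•w` — the linearised averaging the literal's level-0 KKT system carries (an3-g59 [AN3-G59-MCOMP] Q1, located). -/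
theorem qSym_eq_border (L : ℕ) [NeZero L] (ρ : Fin (d + 1)) (w : Site (d + 1)) (κ : Fin (d + 1)) (u : Site (d + 1)) :
    qSym L ρ w κ u = (bhK L + Dsh L : MKer (d + 1) (Fib d)) ((L : ℤ) • w) u (Sum.inr ρ) (Sum.inl κ) := by
  rw [bhK_add_Dsh_inr_inl, if_pos (proj_zsmul (N := L) w), quo_zsmul]
  rfl

/-! ## §2 The literal's composite averaging tables at the limit -/

section Tables

/-- [our object — THE PIN of D1's displayed inter-level conversion `λ`] **`λ = 1` IN PERFECT UNITS** (R-FP-44 (B) Q3: the inter-level ratio of the `unitM` scalings read off an4's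
`colM_unitK` — D1's exponent count: raw border `stepScale_k • q`, raw Hessian table `wM1 k • (cΛ•H)`, the typed-field∕block-sum conversion `(stepScale (k+1))⁻¹` between consecutive typed
systems and `unitM = (s_m²)⁻¹•D⁻¹·D⁻¹` cancel identically).  ARBITER: the m = 2 value check ([AN3-G59-MCOMP] (R-c), an3 gen-35 exact composite tables; calc lane).  ONE token to re-pin. -/
def lamPerfect : ℝ := 1

variable {Lc : ℕ} (tabs : SymTables d Lc) (cΛ : ℝ)

/-- [our object] **THE COMPOSITE m-FOLD MULTIPLIER TABLES OF THE (0.4) LITERAL AT THE LIMIT** (perfect units): `cΛ •` the pure composite constraint Hessian of FILE D1 over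
the one-step data `(qSym Lc, tabs.H)` at the pin `λ = lamPerfect` — `m = 1` is the unit one-step table `cΛ • tabs.H` ((M-H) in units, leaf-02 g12 `unitM_M1Of_of_ff`). -/
def MCompInf (m : ℕ) : Fin (d + 1) → Site (d + 1) → MKer (d + 1) (Fib d) := fun ρ w => cΛ • HComp Lc (qSym Lc) lamPerfect tabs.H m ρ w

/-- [our object] **THE COMPOSITE m-FOLD MIXED TABLES OF THE (0.4) LITERAL AT THE LIMIT**: FILE D1's four-family composite over `(qSym Lc, lamPerfect, tabs.H, tabs.mixFF, cΛ)` —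
`m = 1` is the unit one-step mixed table `tabs.mixFF` ((Shmix) in units, `unitM₂_M2Of_of_ff`). -/
def M2CompInf (m : ℕ) : Fin (d + 1) → Site (d + 1) → Fin (d + 1) → Site (d + 1) → MKer (d + 1) (Fib d) :=
  M2Comp Lc (qSym Lc) lamPerfect tabs.H tabs.mixFF cΛ m

/-- [folklore] **THE m = 1 PIN OF THE MULTIPLIER TABLES**: `MCompInf tabs cΛ 1 = fun ρ w => cΛ • tabs.H ρ w` — the (M) limit `M∞` of parts 1–2 of the row. -/
theorem MCompInf_one : MCompInf tabs cΛ 1 = fun ρ w => cΛ • tabs.H ρ w := by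
  funext ρ w
  simp only [MCompInf, HComp_one]

/-- [folklore] **THE m = 1 PIN OF THE MIXED TABLES**: `M2CompInf tabs cΛ 1 = tabs.mixFF` — the (M₂) limit `M₂∞` of parts 1–2 of the row. -/
theorem M2CompInf_one : M2CompInf tabs cΛ 1 = tabs.mixFF := M2Comp_one _ _ _ _ _ _

/-- [folklore] Block shape: under the (ShH) entry letter the composite multiplier tables have no multiplier rows. -/
theorem MCompInf_inr [NeZero Lc] (hHm : ∀ σ v x z (ν : Fin (d + 1)) (b : Fib d), tabs.H σ v x z (Sum.inr ν) b = 0) (m : ℕ) (ρ : Fin (d + 1)) (w x z : Site (d + 1))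
    (ν : Fin (d + 1)) (b : Fib d) : MCompInf tabs cΛ m ρ w x z (Sum.inr ν) b = 0 := by
  simp only [MCompInf, Pi.smul_apply, smul_eq_mul, HComp_inr Lc (qSym Lc) lamPerfect tabs.H hHm m ρ w x z ν b, mul_zero]

/-- [folklore] Block shape: under the (ShH)(Shmix) entry letters the composite mixed tables have no multiplier rows. -/
theorem M2CompInf_inr [NeZero Lc] (hHm : ∀ σ v x z (ν : Fin (d + 1)) (b : Fib d), tabs.H σ v x z (Sum.inr ν) b = 0)
    (hmixm : ∀ κ u σ v x z (ν : Fin (d + 1)) (b : Fib d), tabs.mixFF κ u σ v x z (Sum.inr ν) b = 0) (m : ℕ) (κ : Fin (d + 1)) (u : Site (d + 1))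
    (ρ : Fin (d + 1)) (w x z : Site (d + 1)) (ν : Fin (d + 1)) (b : Fib d) : M2CompInf tabs cΛ m κ u ρ w x z (Sum.inr ν) b = 0 :=
  M2Comp_inr Lc (qSym Lc) lamPerfect tabs.H tabs.mixFF cΛ hHm hmixm m κ u ρ w x z ν b

end Tables

/-! ## §3 The m-fold second-order table of record at the limit -/

section Record

variable {Lc : ℕ} (G : ℕ → MKer (d + 1) (Fib d)) (tabs : SymTables d Lc) (cΛ : ℝ)
  (Sinf : Fin (d + 1) → Site (d + 1) → MKer (d + 1) (Fib d)) (S₂inf : Fin (d + 1) → Site (d + 1) → Fin (d + 1) → Site (d + 1) → MKer (d + 1) (Fib d))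

/-- [our object — a CANDIDATE asserting nothing] **THE m-FOLD SECOND-ORDER TABLE OF RECORD AT THE LIMIT** (R-FP-41′ ∕ R-FP-44 (B)): an2's carrier at the m-fold K-slot `G m`,
blocking `Lc^m`, the (m-free) fine stencils `S∞`, `S₂∞` and the COMPOSITE m-fold averaging tables —
`WtInf G tabs cΛ S∞ S₂∞ m := W2SymOfK (G m) (Lc^m) S∞ (MCompInf tabs cΛ m) S₂∞ (M2CompInf tabs cΛ m)`.  The K-slot family `G` is a PARAMETER (placement caveat, module
docstring §3): the owner's formula reads `G m := KPerf Lc (sfStep Lc) (smStep d Lc) m`; the literal's `m = 1` carrier reads `G 1 := coDressKSymAt ρ_c Lc (KPerf … 1)`. -/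
def WtInf (m : ℕ) : Fin (d + 1) → Site (d + 1) → Fin (d + 1) → Site (d + 1) → MKer (d + 1) (Fib d) :=
  W2SymOfK (G m) (Lc ^ m) Sinf (MCompInf tabs cΛ m) S₂inf (M2CompInf tabs cΛ m)

/-- [folklore] Unfolding lemma. -/
theorem WtInf_eq (m : ℕ) : WtInf G tabs cΛ Sinf S₂inf m = W2SymOfK (G m) (Lc ^ m) Sinf (MCompInf tabs cΛ m) S₂inf (M2CompInf tabs cΛ m) := rfl

/-- [folklore] **THE m = 1 MEMBER IS THE CARRIER OF PARTS 1–2**: `WtInf G … 1 = W2SymOfK (G 1) Lc S∞ (fun ρ w => cΛ • tabs.H ρ w) S₂∞ tabs.mixFF` — with `G 1 := G∞` and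
`(S∞, S₂∞) := (S♭∞, S₂∞)` literally the right-hand side of leaf-06's `PerfectTableFixedPointSym.limTabOf_unitW_JsB12Sym0_eq_of_rows` ∕ g12's `wPerfOf_JsB12Sym_eq_dress_of_ff`. -/
theorem WtInf_one : WtInf G tabs cΛ Sinf S₂inf 1 = W2SymOfK (G 1) Lc Sinf (fun ρ w => cΛ • tabs.H ρ w) S₂inf tabs.mixFF := by
  rw [WtInf_eq, MCompInf_one, M2CompInf_one, pow_one]

end Record

/-! ## §4 The pin of the END's free family: `m = 1` the literal's tables, `m ≥ 2` constant in units -/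

section Pin

variable (Lc : ℕ) [NeZero Lc]
  (W₁ : ℕ → Fin (d + 1) → Site (d + 1) → Fin (d + 1) → Site (d + 1) → MKer (d + 1) (Fib d))
  (Winf : ℕ → Fin (d + 1) → Site (d + 1) → Fin (d + 1) → Site (d + 1) → MKer (d + 1) (Fib d))

/-- [our object] **THE PIN OF THE END's FREE (j, m)-FAMILY** (R-FP-44 (B) Q1): at `m = 1` the supplied level-`j` tables `W₁ j` (the END's `hWt1`: `(JsB12Sym … j).W`); at `m ≠ 1`
the level-`j` table whose unit-rescaling IS the supplied limit object `Winf m` — `unitW (sfStep Lc j)⁻¹ (smStep d Lc j)⁻¹ (Winf m)` (constant in units). -/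
def WtPin (j m : ℕ) : Fin (d + 1) → Site (d + 1) → Fin (d + 1) → Site (d + 1) → MKer (d + 1) (Fib d) :=
  if m = 1 then W₁ j else unitW (sfStep Lc j)⁻¹ (smStep d Lc j)⁻¹ (Winf m)

omit [NeZero Lc] in
/-- [folklore] **THE END's `hWt1` SHAPE**: `WtPin Lc W₁ Winf j 1 = W₁ j`. -/
theorem WtPin_one (j : ℕ) : WtPin Lc W₁ Winf j 1 = W₁ j := if_pos rfl

omit [NeZero Lc] in
/-- [folklore] Off `m = 1` the pin is the inverse-unit image of the limit object. -/
theorem WtPin_of_ne_one {m : ℕ} (hm : m ≠ 1) (j : ℕ) : WtPin Lc W₁ Winf j m = unitW (sfStep Lc j)⁻¹ (smStep d Lc j)⁻¹ (Winf m) := if_neg hm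

/-- [folklore] **CONSTANT IN UNITS**: for `m ≠ 1` and every `j`, `unitW (sfStep Lc j) (smStep d Lc j) (WtPin Lc W₁ Winf j m) = Winf m` (`unitW_unitW_inv`). -/
theorem unitW_WtPin_of_ne_one {m : ℕ} (hm : m ≠ 1) (j : ℕ) : unitW (sfStep Lc j) (smStep d Lc j) (WtPin Lc W₁ Winf j m) = Winf m := by
  rw [WtPin_of_ne_one Lc W₁ Winf hm j]
  exact unitW_unitW_inv (sfStep_ne_zero j) (smStep_ne_zero (d := d) j) (Winf m)

/-- [our object — bookkeeping] **THE END's PERFECT m-FOLD TABLE IS THE SUPPLIED LIMIT OBJECT** for `m ≠ 1`: `WPerfOf (sfStep Lc) (smStep d Lc) (WtPin Lc W₁ Winf) m = Winf m`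
(`WPerfOf` = `limTabOf` of the unit-rescaled family, which is CONSTANT `= Winf m`).  With `Winf := WtInf G tabs cΛ S♭∞ S₂∞` the END's (hSDF)∕(hsplit) hypotheses for `m ≥ 2`
become statements about ONE explicit carrier per `m`.  Asserts nothing about (SDF). -/
theorem wPerfOf_WtPin_of_ne_one {m : ℕ} (hm : m ≠ 1) : WPerfOf (sfStep Lc) (smStep d Lc) (WtPin Lc W₁ Winf) m = Winf m := by
  unfold WPerfOf
  have e : (fun j => unitW (sfStep Lc j) (smStep d Lc j) (WtPin Lc W₁ Winf j m)) = fun _ => Winf m :=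
    funext fun j => unitW_WtPin_of_ne_one Lc W₁ Winf hm j
  rw [e]
  funext μ y ν y'
  rw [limTabOf_apply]
  exact limMKerOf_eq_of_tendsto fun x z a b => tendsto_const_nhds

omit [NeZero Lc] in
/-- [folklore] **AT `m = 1` THE END's OBJECT IS UNCHANGED**: `WPerfOf (sfStep Lc) (smStep d Lc) (WtPin Lc W₁ Winf) 1 = WPerfOf (sfStep Lc) (smStep d Lc) (fun j _ => W₁ j) 1`. -/
theorem wPerfOf_WtPin_one : WPerfOf (sfStep Lc) (smStep d Lc) (WtPin Lc W₁ Winf) 1 = WPerfOf (sfStep Lc) (smStep d Lc) (fun j _ => W₁ j) 1 := by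
  unfold WPerfOf
  simp only [WtPin_one]

end Pin

end Summit.QuantumFields.BalabanUV.Beta.FP.PerfectSecondOrderTablesInf

end
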